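import Literature.AnabelianGeometry.SemiGraphs.DoubleCosetFibres
import Literature.AnabelianGeometry.SemiGraphs.PSCCuspidalCriterionEasyProofs
import HarnessLib

/-!
# [CombGC] Theorem 1.6 (i), necessity: numerically cuspidal ⟹ group-theoretically cuspidal

Mochizuki, *A combinatorial version of the Grothendieck conjecture*, Tohoku Math. J. **59** (2007)
[CombGC], §1, Theorem 1.6 (i), p. 13, proof pp. 13–14 as AMENDED by [IUTchI] Remark 1.2.3
(iii)(iv) (Mochizuki, *Inter-universal Teichmüller theory I*, kurims manuscript pp. 41–42): "the
cuspidal edge-like subgroups of `Π_G` (respectively, `Π_H`) are precisely the maximal closed subgroups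
`A` such that, for every [characteristic] open … subgroup `A' ⊆ A`, … cuspidally totally ramified …
Thus, we conclude that `α` is group-theoretically cuspidal".  Proof-only companion of
`PSCGraphicity.lean` / `PSCRamification.lean` (abc-iut-L3-t4), seat abc-iut-w4-d052 (cone row
`CombGC:Thm1.6`, part (i)).

Over the interface `PSCDatum Π` the printed argument is the following TRANSPORT, kernel-checked here
for every pair of data `G`, `H` with `Σ_G = Σ_H = {l}` and profinite (compact) `Π_G`, `Π_H`, and every
NUMERICALLY cuspidal `α : Π_G ≅ Π_H`:

* the condition `cond(A)` of [IUTchI] Rmk. 1.2.3 (iv) (closed, topologically cyclic, infinite, and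
  "for every characteristic open `U`, the cyclic covering `G_U → G_{A·U}` is cuspidally totally
  ramified") is carried by `α` to the same condition in `Π_H` (`PSCDatum.cond_map`): the first three
  clauses formally (`α` is a homeomorphic isomorphism), the fourth through the RELATIVE cyclic
  cusp-count criterion [IUTchI] Rmk. 1.2.3 (iii) (`isCuspidallyTotallyRamified_iff_cuspCount_lt`,
  `DoubleCosetFibres.lean`, proved for every datum) — numerical cuspidality is exactly what makes
  the counts `r(G_M)`, `r(G_{A·U})` agree on the two sides (`PSCDatum.clause_map`);
* hence, granting the printed CHARACTERIZATION of cuspidal subgroups by `cond` + maximality for `G`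
  and for `H` (the typed named fact `PSCDatum.CuspidalEdgeLikeCharacterization`, [IUTchI] Rmk.
  1.2.3 (iv) — the deep, origin-dependent input, NOT proved here), `α` maps cuspidal subgroups onto
  cuspidal subgroups: **`PSCDatum.isGroupTheoreticallyCuspidal_of_isNumericallyCuspidal`**;
* with the sufficiency half (`PSCCuspidalCriterionEasyProofs.lean`, from Prop. 1.2 (i)):
  **`PSCDatum.numericallyCuspidalIff_of_characterization : … →
  G.NumericallyCuspidalIffGroupTheoreticallyCuspidal H α`** — Thm. 1.6 (i) as typed, reduced to the
  named facts Prop. 1.2 (i) and Rmk. 1.2.3 (iv) for `G` and `H`.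

Honest scope: (1) `Σ = {l}` only — print's "we may assume, without loss of generality, that
`Σ = {l}`" (p. 13) passes to the maximal pro-`l` quotient, a change-of-`Σ` functoriality the
interface `PSCDatum` does not carry (one datum, one `Σ`); (2) `Π_G`, `Π_H` compact (they are
profinite in print; the interface does not record it), used only for "characteristic open ⟹ finite
index".  Nothing here takes a side on [IUTchIII] Cor. 3.12.
[cite: MochizukiCombGC2007, Thm 1.6(i) pp.13-14] [cite: Mochizuki2012, IUTchI Rmk 1.2.3(iv) pp.41-42]
-/

noncomputable section

namespace Literature.AnabelianGeometry.SemiGraphs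

namespace PSCDatum

open scoped Pointwise

universe u

variable {P : Type u} [Group P] [TopologicalSpace P] [IsTopologicalGroup P]
variable {P' : Type u} [Group P'] [TopologicalSpace P'] [IsTopologicalGroup P']

/-! ### Elementary transports along `α : Π_G ≅ Π_H` -/

section Elementary

variable (α : P ≃ₜ* P')

omit [IsTopologicalGroup P] [IsTopologicalGroup P'] in
/-- The image of an open subgroup under `α` is open. [cite: MochizukiCombGC2007, Def 1.4(ii) p.10] -/
theorem isOpen_map (U : Subgroup P) (hU : IsOpen (U : Set P)) :
    IsOpen ((U.map α.toMulEquiv.toMonoidHom : Subgroup P') : Set P') := by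
  rw [Subgroup.coe_map]
  exact α.toHomeomorph.isOpenMap _ hU

omit [IsTopologicalGroup P] [IsTopologicalGroup P'] in
/-- The preimage of an open subgroup under `α` is open. [cite: MochizukiCombGC2007, Def 1.4(ii) p.10] -/
theorem isOpen_comap (U' : Subgroup P') (hU' : IsOpen (U' : Set P')) :
    IsOpen ((U'.comap α.toMulEquiv.toMonoidHom : Subgroup P) : Set P) := by
  rw [Subgroup.coe_comap]
  exact hU'.preimage α.continuous

omit [TopologicalSpace P] [IsTopologicalGroup P] [TopologicalSpace P'] [IsTopologicalGroup P'] in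
/-- `α⁻¹(α(A)) = A` and `α(α⁻¹(B)) = B`. [cite: MochizukiCombGC2007, Def 1.4(iv) p.11] -/
theorem map_symm_map (e : P ≃* P') (A : Subgroup P) :
    (A.map e.toMonoidHom).map e.symm.toMonoidHom = A := by
  rw [Subgroup.map_map]
  convert Subgroup.map_id A
  ext x
  exact e.symm_apply_apply x

omit [IsTopologicalGroup P] [IsTopologicalGroup P'] in
/-- `α⁻¹(B)` as an image: `B.map α⁻¹ = B.comap α`. [cite: MochizukiCombGC2007, Def 1.4(iv) p.11] -/
theorem map_symm_eq_comap (K : Subgroup P') :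
    K.map α.symm.toMulEquiv.toMonoidHom = K.comap α.toMulEquiv.toMonoidHom := by
  ext x
  simp only [Subgroup.mem_map, Subgroup.mem_comap]
  constructor
  · rintro ⟨y, hy, rfl⟩
    change α (α.symm y) ∈ K
    rw [α.apply_symm_apply]
    exact hy
  · intro hx
    refine ⟨α x, hx, ?_⟩
    change α.symm (α x) = x
    exact α.symm_apply_apply x

omit [TopologicalSpace P] [IsTopologicalGroup P] [TopologicalSpace P'] [IsTopologicalGroup P'] in
/-- A characteristic subgroup is carried to a characteristic subgroup by a group isomorphism.
[cite: Mochizuki2012, IUTchI Rmk 1.2.3(iv) p.41] -/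
theorem characteristic_map (e : P ≃* P') {U : Subgroup P} (hU : U.Characteristic) :
    (U.map e.toMonoidHom).Characteristic := by
  rw [Subgroup.characteristic_iff_map_eq] at hU ⊢
  intro ϕ
  have key := hU (e.trans (ϕ.trans e.symm))
  calc (U.map e.toMonoidHom).map ϕ.toMonoidHom
      = ((U.map (e.trans (ϕ.trans e.symm)).toMonoidHom).map e.toMonoidHom) := by
        rw [Subgroup.map_map, Subgroup.map_map]
        congr 1
        ext x
        simp
    _ = U.map e.toMonoidHom := by rw [key]

omit [IsTopologicalGroup P] [IsTopologicalGroup P'] in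
/-- An open subgroup of a compact group has finite index (used for: characteristic open subgroups
of the profinite `Π_G` are of finite index). [cite: MochizukiCombGC2007, Def 1.1(ii) p.6] -/
theorem finiteIndex_of_isOpen [IsTopologicalGroup P] [CompactSpace P] (U : Subgroup P)
    (hU : IsOpen (U : Set P)) : U.FiniteIndex := by
  haveI : DiscreteTopology (P ⧸ U) := QuotientGroup.discreteTopology hU
  haveI : Finite (P ⧸ U) := finite_of_compact_of_discrete
  exact Subgroup.finiteIndex_of_finite_quotient

end Elementary

/-! ### Numerical cuspidality is symmetric -/

section Symm

variable {G : PSCDatum P} {H : PSCDatum P'} {α : P ≃ₜ* P'}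

omit [IsTopologicalGroup P] [IsTopologicalGroup P'] in
/-- If `α` is numerically cuspidal then so is `α⁻¹`. [cite: MochizukiCombGC2007, Def 1.4(ii) p.10] -/
theorem IsNumericallyCuspidal.symm (h : G.IsNumericallyCuspidal H α) :
    H.IsNumericallyCuspidal G α.symm := by
  intro U' hU'
  have hU := isOpen_map α.symm U' hU'
  rw [h _ hU]
  congr 1
  exact (map_symm_map α.symm.toMulEquiv U').symm

end Symm

/-! ### The transport of "`G_U → G_{A·U}` is cuspidally totally ramified" along a numerically cuspidal `α` -/

section Clause

variable {G : PSCDatum P} {H : PSCDatum P'} {α : P ≃ₜ* P'}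

/-- **The key transport** ([CombGC] p. 14 "it follows from the assumption that `α` is numerically
cuspidal that `G'' → G'` is cuspidally … totally ramified if and only if `H'' → H'` is", in the
amended form of [IUTchI] Rmk. 1.2.3 (iii)(iv)): for `Σ_G = Σ_H = {l}`, `Π_G`, `Π_H` compact, `α`
numerically cuspidal, `A = \overline{⟨a⟩}` topologically cyclic and `U` characteristic open in `Π_G`:
if `G_U → G_{A·U}` is cuspidally totally ramified then so is `H_{α U} → H_{α A · α U}`.
[cite: Mochizuki2012, IUTchI Rmk 1.2.3(iv) p.42] -/
theorem clause_map [CompactSpace P] [CompactSpace P'] {l : ℕ} (hS : G.Sigma = {l})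
    (hS' : H.Sigma = {l}) (hnum : G.IsNumericallyCuspidal H α) {A U : Subgroup P} {a : P}
    (hA : (Subgroup.zpowers a).topologicalClosure = A) (hU : U.Characteristic)
    (hUo : IsOpen (U : Set P)) (h : G.IsCuspidallyTotallyRamified (A ⊔ U) U) :
    H.IsCuspidallyTotallyRamified
      (A.map α.toMulEquiv.toMonoidHom ⊔ U.map α.toMulEquiv.toMonoidHom)
      (U.map α.toMulEquiv.toMonoidHom) := by
  have hl := G.prime_of_sigma_eq hS
  haveI : U.Characteristic := hU
  haveI hUn : U.Normal := inferInstance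
  haveI : U.FiniteIndex := finiteIndex_of_isOpen U hUo
  set f := α.toMulEquiv.toMonoidHom with hf
  have hfs : Function.Surjective f := α.surjective
  have hfi : Function.Injective f := α.injective
  set U' : Subgroup P' := U.map f with hU'
  set A' : Subgroup P' := A.map f with hA'
  have hU'o : IsOpen (U' : Set P') := isOpen_map α U hUo
  haveI hU'n : U'.Normal := hUn.map f hfs
  haveI : U'.FiniteIndex := finiteIndex_of_isOpen U' hU'o
  have hGal' : ∀ B' : Subgroup P', U' ≤ B' → IsGaloisCovering B' U' := fun B' hB' =>
    ⟨hB', hU'o, Subgroup.isOpen_mono hB' hU'o, inferInstance⟩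
  by_cases hAU : A ≤ U
  · -- trivial covering: the clause only says that there is a cusp
    have hAU' : A' ≤ U' := Subgroup.map_mono hAU
    rw [sup_eq_right.mpr hAU']
    obtain ⟨-, c, -, -⟩ := h
    have hr : Fintype.card G.graph.C = Fintype.card H.graph.C := by
      have h1 := hnum ⊤ (by rw [Subgroup.coe_top]; exact isOpen_univ)
      rw [Subgroup.map_top_of_surjective _ hfs, cuspCount_top, cuspCount_top] at h1
      exact h1
    obtain ⟨c'⟩ : Nonempty H.graph.C :=
      Fintype.card_pos_iff.mp (hr ▸ Fintype.card_pos_iff.mpr ⟨c⟩)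
    exact ⟨hGal' U' le_rfl, c', 1, sup_eq_right.mpr inf_le_left⟩
  · -- the cyclic covering `G_U → G_{A·U}` of degree `l ^ j`, `0 < j`
    have hgen : U ⊔ Subgroup.zpowers a = A ⊔ U := by
      rw [← hA]
      apply le_antisymm
      · exact sup_le le_sup_right ((Subgroup.le_topologicalClosure _).trans le_sup_left)
      · refine sup_le ?_ le_sup_left
        exact Subgroup.topologicalClosure_minimal _ le_sup_right
          (Subgroup.isClosed_of_isOpen _ (Subgroup.isOpen_mono le_sup_left hUo))
    obtain ⟨m, hm⟩ := G.index_eq_pow_of_sigma_eq hS hUo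
    obtain ⟨j, -, hj⟩ := (Nat.dvd_prime_pow hl).mp (hm ▸
      Subgroup.relIndex_dvd_index_of_le (le_sup_right : U ≤ A ⊔ U))
    have hjpos : 0 < j := by
      rcases Nat.eq_zero_or_pos j with rfl | hpos
      · exfalso
        apply hAU
        rw [pow_zero, Subgroup.relIndex_eq_one] at hj
        exact le_sup_left.trans hj
      · exact hpos
    have ha : a ∈ A ⊔ U := by
      rw [← hA]
      exact Subgroup.mem_sup_left (Subgroup.le_topologicalClosure _ (Subgroup.mem_zpowers a))
    haveI : (A ⊔ U).FiniteIndex := Subgroup.finiteIndex_of_le (le_sup_right : U ≤ A ⊔ U)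
    have hcount := (G.isCuspidallyTotallyRamified_iff_cuspCount_lt hS hjpos
      ⟨h.1, a, ha, hgen⟩ hj).mp h
    -- the same structure on the `H` side
    have hgen' : U' ⊔ Subgroup.zpowers (f a) = A' ⊔ U' := by
      rw [hU', hA', ← MonoidHom.map_zpowers, ← Subgroup.map_sup, hgen, Subgroup.map_sup]
    have hj' : U'.relIndex (A' ⊔ U') = l ^ j := by
      rw [hU', hA', ← Subgroup.map_sup, Subgroup.relIndex_map_map_of_injective _ _ hfi]
      exact hj
    have ha' : f a ∈ A' ⊔ U' := by
      rw [hU', hA', ← Subgroup.map_sup]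
      exact Subgroup.mem_map_of_mem f ha
    haveI : (A' ⊔ U').FiniteIndex := Subgroup.finiteIndex_of_le (le_sup_right : U' ≤ A' ⊔ U')
    refine (H.isCuspidallyTotallyRamified_iff_cuspCount_lt hS' hjpos
      ⟨hGal' _ le_sup_right, f a, ha', hgen'⟩ hj').mpr fun M' hU'M' hM'B' hidx' => ?_
    -- pull the intermediate covering back to `G`
    set M : Subgroup P := M'.comap f with hM
    have hMmap : M.map f = M' := Subgroup.map_comap_eq_self_of_surjective hfs M'
    have hUM : U ≤ M := fun u hu => Subgroup.mem_comap.mpr (hU'M' (Subgroup.mem_map_of_mem f hu))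
    have hMB : M ≤ A ⊔ U := by
      have := Subgroup.comap_mono (f := f) hM'B'
      rwa [hU', hA', ← Subgroup.map_sup, Subgroup.comap_map_eq_self_of_injective hfi] at this
    have hidx : M.relIndex (A ⊔ U) = l := by
      rw [← Subgroup.relIndex_map_map_of_injective M (A ⊔ U) hfi, hMmap, Subgroup.map_sup]
      exact hidx'
    have hlt := hcount M hUM hMB hidx
    have hMo : IsOpen (M : Set P) := Subgroup.isOpen_mono hUM hUo
    have hBo : IsOpen ((A ⊔ U : Subgroup P) : Set P) := Subgroup.isOpen_mono le_sup_right hUo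
    rw [hnum M hMo, hnum (A ⊔ U) hBo, hMmap, Subgroup.map_sup] at hlt
    exact hlt

/-- **Transport of the condition of [IUTchI] Rmk. 1.2.3 (iv)**: for `Σ_G = Σ_H = {l}`, compact
`Π_G`, `Π_H` and numerically cuspidal `α`, if `A ≤ Π_G` is closed, topologically cyclic, infinite, and
`G_U → G_{A·U}` is cuspidally totally ramified for every characteristic open `U`, then `α(A)` has the
same four properties in `Π_H`. [cite: Mochizuki2012, IUTchI Rmk 1.2.3(iv) p.42] -/
theorem cond_map [CompactSpace P] [CompactSpace P'] {l : ℕ} (hS : G.Sigma = {l})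
    (hS' : H.Sigma = {l}) (hnum : G.IsNumericallyCuspidal H α) {A : Subgroup P}
    (h1 : IsClosed (A : Set P)) (h2 : ∃ a : P, (Subgroup.zpowers a).topologicalClosure = A)
    (h3 : (A : Set P).Infinite)
    (h4 : ∀ U : Subgroup P, U.Characteristic → IsOpen (U : Set P) →
      G.IsCuspidallyTotallyRamified (A ⊔ U) U) :
    IsClosed ((A.map α.toMulEquiv.toMonoidHom : Subgroup P') : Set P') ∧
      (∃ a' : P', (Subgroup.zpowers a').topologicalClosure = A.map α.toMulEquiv.toMonoidHom) ∧
      ((A.map α.toMulEquiv.toMonoidHom : Subgroup P') : Set P').Infinite ∧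
      ∀ U' : Subgroup P', U'.Characteristic → IsOpen (U' : Set P') →
        H.IsCuspidallyTotallyRamified
          (A.map α.toMulEquiv.toMonoidHom ⊔ U') U' := by
  obtain ⟨a, ha⟩ := h2
  refine ⟨?_, ⟨α a, ?_⟩, ?_, fun U' hU' hU'o => ?_⟩
  · rw [Subgroup.coe_map]
    exact α.toHomeomorph.isClosedMap _ h1
  · rw [← ha, map_topologicalClosure, MonoidHom.map_zpowers]
    rfl
  · rw [Subgroup.coe_map]
    exact h3.image α.injective.injOn
  · -- pull `U'` back to the characteristic open subgroup `α⁻¹(U')` of `Π_G`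
    set U : Subgroup P := U'.comap α.toMulEquiv.toMonoidHom with hU
    have hUmap : U.map α.toMulEquiv.toMonoidHom = U' :=
      Subgroup.map_comap_eq_self_of_surjective α.surjective U'
    have hUchar : U.Characteristic := by
      have := characteristic_map α.symm.toMulEquiv hU'
      rw [map_symm_eq_comap α] at this
      exact this
    have hUo : IsOpen (U : Set P) := isOpen_comap α U' hU'o
    have key := clause_map hS hS' hnum ha hUchar hUo (h4 U hUchar hUo)
    rwa [hUmap] at key

end Clause

/-! ### Theorem 1.6 (i), necessity, from the characterization of [IUTchI] Rmk. 1.2.3 (iv) -/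

section Necessity

variable {G : PSCDatum P} {H : PSCDatum P'} {α : P ≃ₜ* P'}

/-- **Cuspidal goes to cuspidal**: under the hypotheses of `cond_map`, granting the characterization
of cuspidal subgroups of [IUTchI] Rmk. 1.2.3 (iv) for `G` and for `H` (named facts), a numerically
cuspidal `α` carries every cuspidal subgroup of `Π_G` onto a cuspidal subgroup of `Π_H`.
[cite: MochizukiCombGC2007, Thm 1.6(i) p.14] -/
theorem isCuspidal_map_of_isNumericallyCuspidal [CompactSpace P] [CompactSpace P'] {l : ℕ}
    (hS : G.Sigma = {l}) (hS' : H.Sigma = {l}) (hG : G.CuspidalEdgeLikeCharacterization)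
    (hH : H.CuspidalEdgeLikeCharacterization) (hnum : G.IsNumericallyCuspidal H α)
    {A : Subgroup P} (hA : G.IsCuspidal A) :
    H.IsCuspidal (A.map α.toMulEquiv.toMonoidHom) := by
  have hGl := hG l hS
  have hHl := hH l hS'
  dsimp only at hGl hHl
  obtain ⟨⟨h1, h2, h3, h4⟩, hmax⟩ := (hGl A).mp hA
  refine (hHl _).mpr ⟨cond_map hS hS' hnum h1 h2 h3 h4, fun B' hB' hAB' => ?_⟩
  -- maximality: pull `B'` back along `α`
  obtain ⟨k1, k2, k3, k4⟩ := hB'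
  have hback := cond_map (α := α.symm) hS' hS hnum.symm k1 k2 k3 k4
  rw [map_symm_eq_comap α] at hback
  obtain ⟨j1, j2, j3, j4⟩ := hback
  have hAB : A ≤ B'.comap α.toMulEquiv.toMonoidHom := fun x hx =>
    Subgroup.mem_comap.mpr (hAB' (Subgroup.mem_map_of_mem _ hx))
  have hEq := hmax _ ⟨j1, j2, j3, j4⟩ hAB
  rw [hEq]
  exact Subgroup.map_comap_eq_self_of_surjective α.surjective B'

/-- **[CombGC] Theorem 1.6 (i), necessity** ("… Thus, we conclude that `α` is group-theoretically
cuspidal, as desired", p. 14), in the amended form of [IUTchI] Rmk. 1.2.3 (iii)(iv), REDUCED over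
the interface to the characterization of cuspidal subgroups (Rmk. 1.2.3 (iv), the named fact
`CuspidalEdgeLikeCharacterization`) for `G` and for `H`: for `Σ_G = Σ_H = {l}`, compact `Π_G`,
`Π_H`, a numerically cuspidal `α : Π_G ≅ Π_H` is group-theoretically cuspidal.
[cite: MochizukiCombGC2007, Thm 1.6(i) p.14] -/
theorem isGroupTheoreticallyCuspidal_of_isNumericallyCuspidal [CompactSpace P] [CompactSpace P']
    {l : ℕ} (hS : G.Sigma = {l}) (hS' : H.Sigma = {l}) (hG : G.CuspidalEdgeLikeCharacterization)
    (hH : H.CuspidalEdgeLikeCharacterization) (hnum : G.IsNumericallyCuspidal H α) :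
    G.IsGroupTheoreticallyCuspidal H α := by
  refine ⟨fun A hA => isCuspidal_map_of_isNumericallyCuspidal hS hS' hG hH hnum hA,
    fun B hB => ⟨B.comap α.toMulEquiv.toMonoidHom, ?_,
      Subgroup.map_comap_eq_self_of_surjective α.surjective B⟩⟩
  have := isCuspidal_map_of_isNumericallyCuspidal (α := α.symm) hS' hS hH hG hnum.symm hB
  rwa [map_symm_eq_comap α] at this

/-- **[CombGC] Theorem 1.6 (i) as typed** (`NumericallyCuspidalIffGroupTheoreticallyCuspidal`),
REDUCED over the interface to the named facts it cites: Prop. 1.2 (i) (edge-like case,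
`EdgeLikeOpenInterDeterminesEdge`) for sufficiency and [IUTchI] Rmk. 1.2.3 (iv)
(`CuspidalEdgeLikeCharacterization`) for necessity, each for `G` and for `H`; `Σ_G = Σ_H = {l}`,
`Π_G`, `Π_H` compact. [cite: MochizukiCombGC2007, Thm 1.6(i) p.13] -/
theorem numericallyCuspidalIff_of_characterization [CompactSpace P] [CompactSpace P'] {l : ℕ}
    (hS : G.Sigma = {l}) (hS' : H.Sigma = {l}) (hG₁ : G.EdgeLikeOpenInterDeterminesEdge)
    (hH₁ : H.EdgeLikeOpenInterDeterminesEdge) (hG₂ : G.CuspidalEdgeLikeCharacterization)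
    (hH₂ : H.CuspidalEdgeLikeCharacterization) :
    G.NumericallyCuspidalIffGroupTheoreticallyCuspidal H α :=
  ⟨isGroupTheoreticallyCuspidal_of_isNumericallyCuspidal hS hS' hG₂ hH₂,
    isNumericallyCuspidal_of_isGroupTheoreticallyCuspidal hG₁ hH₁⟩

/-- **[CombGC] Theorem 1.6 (i), sufficiency, as printed over the origin parameter**: for every `Ω`,
the named fact "Prop. 1.2 (i)" (`OpenInterDeterminesComponentHolds Ω`) implies, for all `G`, `H` of
PSC-type and every `α : Π_G ≅ Π_H`, "group-theoretically cuspidal ⟹ numerically cuspidal" — no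
restriction on `Σ`, no compactness. [cite: MochizukiCombGC2007, Thm 1.6(i) p.13] -/
theorem numericallyCuspidal_of_groupTheoreticallyCuspidal_holds (Ω : PSCOrigin.{u})
    (h12 : OpenInterDeterminesComponentHolds Ω)
    ⦃Q : Type u⦄ [Group Q] [TopologicalSpace Q] [IsTopologicalGroup Q]
    ⦃Q' : Type u⦄ [Group Q'] [TopologicalSpace Q'] [IsTopologicalGroup Q']
    (G : PSCDatum Q) (H : PSCDatum Q') (α : Q ≃ₜ* Q') (hG : Ω.IsOfPSCType G)
    (hH : Ω.IsOfPSCType H) :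
    G.IsGroupTheoreticallyCuspidal H α → G.IsNumericallyCuspidal H α :=
  isNumericallyCuspidal_of_isGroupTheoreticallyCuspidal (h12 G hG).2.1 (h12 H hH).2.1

end Necessity

end PSCDatum

end Literature.AnabelianGeometry.SemiGraphs

end
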